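import Mathlib
import HarnessLib

/-!
# Khovanskii's theorem: polynomial growth of sumsets (Nathanson–Ruzsa's lattice-point proof)

Topic `Literature/Combinatorics/Additive`.

**Theorem (Khovanskii 1992; Nathanson–Ruzsa 2002, Theorem 1).** "Let `S` be an abelian semigroup,
and let `A` be a finite nonempty subset of `S`. There exists a polynomial `p(t)` such that
`|hA| = p(h)` for all sufficiently large `h`." [cite: NathansonRuzsa2002, Theorem 1]
[cite: Khovanskii1992, Theorem 1]. Here `hA` is the set of all sums of `h` elements of `A`, with
repetitions allowed.

We follow the elementary proof of Nathanson and Ruzsa [cite: NathansonRuzsa2002, §2] verbatim.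
The semigroup is taken to be an additive commutative monoid `S` (as the source remarks, one may
adjoin an identity without loss of generality), `hA` is Mathlib's iterated pointwise sumset
`h • A : Finset S` (so `0 • A = {0}`), and for `A = {a₁, …, a_k}` the lattice `ℕ₀^k` is `Fin k → ℕ`
with the product partial order `≤` of Mathlib and the lexicographic order through `toLex`.

* `mem_piAntidiag_univ`, `card_piAntidiag_univ`, `card_piAntidiag_univ_polynomial` — the simplex
  `σ(h) = {x ∈ ℕ₀^k : x₁ + ⋯ + x_k = h}` is `Finset.univ.piAntidiag h`, of cardinality
  `C(h + k − 1, k − 1)`, a polynomial in `h` of degree `k − 1` (for `k ≥ 1`; for `k = 0` it is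
  eventually `0`) [cite: NathansonRuzsa2002, §2, display before Lemma 1].
* `card_filter_le_piAntidiag` — **Lemma 1** in the form used: `B(h, {w}) = {w} + σ(h − ht(w))`, so
  `|{x ∈ σ(h) : x ≥ w}| = |σ(h − ht(w))|` for `h ≥ ht(w)` [cite: NathansonRuzsa2002, Lemma 1]
  (the reduction `B(h, W) = B(h, {w*})`, `w* = sup W`, is built into the recursion below, which
  carries a single lower bound `v` and replaces it by `v ⊔ w`).
* **Lemma 2 (Dickson's lemma)** is Mathlib's `Pi.wellQuasiOrderedLE` together with
  `WellQuasiOrderedLE.finite_of_isAntichain` (the minimal elements of an upper set of `ℕ₀^k` form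
  a finite antichain `W*`) and `exists_minimal_le_of_wellFoundedLT` (every element of the upper
  set lies above one of them) — used inside `card_image_piAntidiag_polynomial`.
* `card_filter_count_polynomial` — the inclusion–exclusion step of the proof of Theorem 1,
  rendered as the finite recursion
  `#{x ∈ σ(h) : x ≥ v, x ≱ w (w ∈ W ∪ {w₀})} = #{… x ≥ v, x ≱ w (w ∈ W)} − #{… x ≥ v ⊔ w₀, x ≱ w (w ∈ W)}`
  over the finite set `W*` of Dickson generators, each term being eventually polynomial of degree
  `≤ k − 1` by Lemma 1.
* `card_image_piAntidiag_polynomial` — **Theorem 1 for a family** `a : Fin k → S`: with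
  `f(x) = Σ xᵢ • aᵢ` (a homomorphism `ℕ₀^k → S` with `f(σ(h)) = hA`), the *useless* lattice points
  (`x` such that some `u ∈ σ(ht x)` has `f(u) = f(x)` and `u <_lex x`) form an upper set ("ideal")
  `I`; `|f(σ(h))|` is the number of points of `σ(h)` outside `I` (each fibre has exactly one
  lexicographically least point); Dickson + the recursion give a polynomial `p ∈ ℚ[t]` of degree
  `≤ k − 1` and `h₀` with `|f(σ(h))| = p(h)` for `h ≥ h₀` [cite: NathansonRuzsa2002, proof of Theorem 1].
* `nsmul_eq_image_piAntidiag` — `hA = f(σ(h))` for any enumeration `a` of `A`.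
* `khovanskii` — **Theorem 1** as printed, for every finite `A ⊆ S` (the empty set included:
  `h • ∅ = ∅` for `h ≥ 1`), with the degree bound `deg p ≤ |A| − 1`.

Not treated here: the multivariate form for linear forms `h₁A₁ + ⋯ + h_rA_r`
[cite: NathansonRuzsa2002, Theorem 2] (`-- TODO(general form)`), and Khovanskii's statement that
the degree equals the dimension of the affine hull when `S = ℤ^d`.

FAIL-DUP check (2026-08-28): Mathlib (pin of this tree) has no form of Khovanskii's theorem
(`rg -i khovanski` over Mathlib: no hit; only the pointwise `nsmul` API on `Finset`); the tree has
the one-dimensional integer case only (`IteratedSumsetStructure.lean`: Nathanson GTM 165 Thm 1.1,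
`|hA|` eventually linear for `A ⊂ ℤ`).

## References

* M. B. Nathanson, I. Z. Ruzsa, *Polynomial growth of sumsets in abelian semigroups*, J. Théor.
  Nombres Bordeaux 14 (2002) 553–560 (arXiv:math/0204052), §2: Lemma 1, Lemma 2 (Dickson),
  Theorem 1. [NathansonRuzsa2002]
* A. G. Khovanskiĭ, *The Newton polytope, the Hilbert polynomial and sums of finite sets*,
  Funktsional. Anal. i Prilozhen. 26 (1992), no. 4, 57–63 (Funct. Anal. Appl. 26 (1992) 276–281),
  Theorem 1 (the original, via Hilbert polynomials of graded modules). [Khovanskii1992]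
-/

namespace Literature.Combinatorics.Additive.KhovanskiiTheorem

open Finset Polynomial
open scoped Pointwise Classical

variable {S : Type*} [AddCommMonoid S] [DecidableEq S] {k : ℕ}

/-! ### The simplices `σ(h)` -/

/-- `σ(h) = {x ∈ ℕ₀^k : x₁ + ⋯ + x_k = h}` is `Finset.univ.piAntidiag h`
[cite: NathansonRuzsa2002, §2]. -/
theorem mem_piAntidiag_univ {x : Fin k → ℕ} {h : ℕ} :
    x ∈ (univ : Finset (Fin k)).piAntidiag h ↔ ∑ i, x i = h := by
  simp [Finset.mem_piAntidiag]

/-- `|σ(h)| = C(h + k − 1, h) = C(h + k − 1, k − 1)`, the number of ordered partitions of `h` into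
`k` non-negative parts [cite: NathansonRuzsa2002, §2, display before Lemma 1]. -/
theorem card_piAntidiag_univ (k h : ℕ) :
    #((univ : Finset (Fin k)).piAntidiag h) = (k + h - 1).choose h := by
  have hc := card_finsuppAntidiag_nat_eq_choose (s := (univ : Finset (Fin k))) h
  rw [Finset.finsuppAntidiag, card_map, card_attach, card_univ, Fintype.card_fin] at hc
  exact hc

/-- `|σ(h)|` "is a polynomial in `h` for fixed `k`" [cite: NathansonRuzsa2002, §2, display before
Lemma 1]: there is `p ∈ ℚ[t]` of degree `≤ k − 1` with `|σ(h)| = p(h)` for all `h ≥ h₀`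
(`h₀ = 0` when `k ≥ 1`; for `k = 0`, `σ(h) = ∅` for `h ≥ 1 = h₀` and `p = 0`). -/
theorem card_piAntidiag_univ_polynomial (k : ℕ) :
    ∃ p : ℚ[X], p.natDegree ≤ k - 1 ∧ ∃ h₀ : ℕ, ∀ h, h₀ ≤ h →
      ((#((univ : Finset (Fin k)).piAntidiag h) : ℕ) : ℚ) = p.eval (h : ℚ) := by
  rcases k with _ | k
  · refine ⟨0, by simp, 1, fun h hh => ?_⟩
    rw [card_piAntidiag_univ, eval_zero, Nat.choose_eq_zero_of_lt (by omega), Nat.cast_zero]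
  · refine ⟨(ascPochhammer ℚ k).comp (X + C 1) * C ((k.factorial : ℚ)⁻¹), ?_, 0, fun h _ => ?_⟩
    · refine (natDegree_mul_C_le _ _).trans ?_
      rw [natDegree_comp, natDegree_X_add_C, mul_one, ascPochhammer_natDegree]
      simp
    · rw [card_piAntidiag_univ, eval_mul, eval_comp, eval_add, eval_X, eval_C, eval_C,
        show k + 1 + h - 1 = h + k by omega, Nat.choose_symm_add]
      have h1 := Nat.ascFactorial_eq_factorial_mul_choose h k
      have h2 := ascPochhammer_nat_eq_ascFactorial (h + 1) k
      have h3 := ascPochhammer_eval_cast ℚ k (h + 1)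
      rw [h2, h1, Nat.cast_mul] at h3
      push_cast at h3
      have hk : (k.factorial : ℚ) ≠ 0 := by positivity
      field_simp
      linarith [h3]

/-! ### Lemma 1: translates of simplices -/

/-- **Lemma 1** [cite: NathansonRuzsa2002, Lemma 1], for a single lower bound `w`:
`B(h, {w}) = {x ∈ σ(h) : x ≥ w} = {w} + σ(h − ht(w))`, so `|B(h, {w})| = |σ(h − ht(w))|`
for `h ≥ ht(w) = Σ wᵢ`. -/
theorem card_filter_le_piAntidiag (w : Fin k → ℕ) {h : ℕ} (hw : ∑ i, w i ≤ h) :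
    #{x ∈ (univ : Finset (Fin k)).piAntidiag h | w ≤ x} =
      #((univ : Finset (Fin k)).piAntidiag (h - ∑ i, w i)) := by
  refine card_nbij' (fun x => x - w) (fun y => y + w) ?_ ?_ ?_ ?_
  · intro x hx
    rw [mem_coe, mem_filter, mem_piAntidiag_univ] at hx
    rw [mem_coe, mem_piAntidiag_univ, ← hx.1]
    simp only [Pi.sub_apply]
    rw [sum_tsub_distrib _ fun i _ => hx.2 i]
  · intro y hy
    rw [mem_coe, mem_piAntidiag_univ] at hy
    rw [mem_coe, mem_filter, mem_piAntidiag_univ]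
    refine ⟨?_, le_add_self⟩
    simp only [Pi.add_apply]
    rw [sum_add_distrib, hy]
    omega
  · intro x hx
    rw [mem_coe, mem_filter] at hx
    exact tsub_add_cancel_of_le hx.2
  · intro y _
    exact add_tsub_cancel_right y w

/-! ### The inclusion–exclusion recursion -/

/-- The counting functions of the proof of Theorem 1 [cite: NathansonRuzsa2002, proof of Theorem 1,
inclusion–exclusion over `W ⊆ W*`], organised as a recursion: for a lower bound `v ∈ ℕ₀^k` and a
finite set `W ⊆ ℕ₀^k` of forbidden lower bounds, the number of `x ∈ σ(h)` with `x ≥ v` and `x ≱ w`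
for all `w ∈ W` is, for all large `h`, a polynomial in `h` of degree `≤ k − 1`.  (Induction on `W`:
removing the condition `x ≱ w₀` adds exactly the points with `x ≥ v ⊔ w₀`; the base case `W = ∅`
is Lemma 1 with `B(h, V) = B(h, {sup V})`.) -/
theorem card_filter_count_polynomial (W : Finset (Fin k → ℕ)) :
    ∀ v : Fin k → ℕ, ∃ p : ℚ[X], p.natDegree ≤ k - 1 ∧ ∃ h₀ : ℕ, ∀ h, h₀ ≤ h →
      ((#{x ∈ (univ : Finset (Fin k)).piAntidiag h | v ≤ x ∧ ∀ w ∈ W, ¬ w ≤ x} : ℕ) : ℚ) =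
        p.eval (h : ℚ) := by
  induction W using Finset.induction_on with
  | empty =>
    intro v
    obtain ⟨p, hdeg, h₀, hp⟩ := card_piAntidiag_univ_polynomial k
    refine ⟨p.comp (X - C ((∑ i, v i : ℕ) : ℚ)), ?_, h₀ + ∑ i, v i, fun h hh => ?_⟩
    · rw [natDegree_comp, natDegree_X_sub_C, mul_one]
      exact hdeg
    · have hfilter : ({x ∈ (univ : Finset (Fin k)).piAntidiag h | v ≤ x ∧ ∀ w ∈ (∅ : Finset _),
          ¬ w ≤ x} : Finset (Fin k → ℕ)) = {x ∈ (univ : Finset (Fin k)).piAntidiag h | v ≤ x} :=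
        filter_congr fun x _ => by simp
      rw [hfilter, card_filter_le_piAntidiag v (by omega), hp _ (by omega), eval_comp, eval_sub,
        eval_X, eval_C, Nat.cast_sub (by omega)]
  | insert w₀ W hw₀ ih =>
    intro v
    obtain ⟨p₁, hdeg₁, h₁, hp₁⟩ := ih v
    obtain ⟨p₂, hdeg₂, h₂, hp₂⟩ := ih (v ⊔ w₀)
    refine ⟨p₁ - p₂, (natDegree_sub_le _ _).trans (max_le hdeg₁ hdeg₂), max h₁ h₂, fun h hh => ?_⟩
    have hsplit := card_filter_add_card_filter_not
      (s := {x ∈ (univ : Finset (Fin k)).piAntidiag h | v ≤ x ∧ ∀ w ∈ W, ¬ w ≤ x})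
      (p := fun x => ¬ w₀ ≤ x)
    rw [filter_filter, filter_filter] at hsplit
    have e1 : ({x ∈ (univ : Finset (Fin k)).piAntidiag h | (v ≤ x ∧ ∀ w ∈ W, ¬ w ≤ x) ∧ ¬ w₀ ≤ x}
        : Finset (Fin k → ℕ)) =
        {x ∈ (univ : Finset (Fin k)).piAntidiag h | v ≤ x ∧ ∀ w ∈ insert w₀ W, ¬ w ≤ x} :=
      filter_congr fun x _ => by
        simp only [forall_mem_insert]
        tauto
    have e2 : ({x ∈ (univ : Finset (Fin k)).piAntidiag h | (v ≤ x ∧ ∀ w ∈ W, ¬ w ≤ x) ∧ ¬¬ w₀ ≤ x}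
        : Finset (Fin k → ℕ)) =
        {x ∈ (univ : Finset (Fin k)).piAntidiag h | v ⊔ w₀ ≤ x ∧ ∀ w ∈ W, ¬ w ≤ x} :=
      filter_congr fun x _ => by
        rw [sup_le_iff]
        tauto
    rw [e1, e2] at hsplit
    have := hp₁ h (le_of_max_le_left hh)
    have := hp₂ h (le_of_max_le_right hh)
    rw [eval_sub]
    have hcast : ((#{x ∈ (univ : Finset (Fin k)).piAntidiag h | v ≤ x ∧ ∀ w ∈ insert w₀ W, ¬ w ≤ x}
        : ℕ) : ℚ) + ((#{x ∈ (univ : Finset (Fin k)).piAntidiag h | v ⊔ w₀ ≤ x ∧ ∀ w ∈ W, ¬ w ≤ x}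
        : ℕ) : ℚ) = ((#{x ∈ (univ : Finset (Fin k)).piAntidiag h | v ≤ x ∧ ∀ w ∈ W, ¬ w ≤ x}
        : ℕ) : ℚ) := by
      exact_mod_cast hsplit
    linarith

/-! ### Theorem 1 -/

/-- **Theorem 1, for a family** `a : Fin k → S` [cite: NathansonRuzsa2002, Theorem 1 and its
proof]: with `f(x) = Σᵢ xᵢ • aᵢ`, the cardinality of `f(σ(h))` (`= hA` for `A = {a₁, …, a_k}`) is
a polynomial in `h` of degree `≤ k − 1` for all sufficiently large `h`.  Proof as printed: the
useless lattice points form an upper set `I` of `ℕ₀^k`; `|f(σ(h))| = |σ(h) ∖ I|`; Dickson's lemma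
(Mathlib's `Pi.wellQuasiOrderedLE`) gives a finite `W*` with `I = {x : x ≥ w for some w ∈ W*}`;
conclude by `card_filter_count_polynomial`. -/
theorem card_image_piAntidiag_polynomial (a : Fin k → S) :
    ∃ p : ℚ[X], p.natDegree ≤ k - 1 ∧ ∃ h₀ : ℕ, ∀ h, h₀ ≤ h →
      ((#(((univ : Finset (Fin k)).piAntidiag h).image fun x => ∑ i, x i • a i) : ℕ) : ℚ) =
        p.eval (h : ℚ) := by
  -- the homomorphism `f`
  set f : (Fin k → ℕ) → S := fun x => ∑ i, x i • a i with hf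
  have hf_add : ∀ x y, f (x + y) = f x + f y := fun x y => by
    simp only [hf, Pi.add_apply, add_nsmul, sum_add_distrib]
  -- the useless ideal
  set U : Set (Fin k → ℕ) :=
    {x | ∃ u, ∑ i, u i = ∑ i, x i ∧ f u = f x ∧ toLex u < toLex x} with hU_def
  have hU : ∀ x y, x ∈ U → x ≤ y → y ∈ U := by
    rintro x y ⟨u, hsum, hfu, hlt⟩ hxy
    refine ⟨u + (y - x), ?_, ?_, ?_⟩
    · have e1 : ∑ i, (u + (y - x)) i = ∑ i, u i + ∑ i, (y - x) i := by
        simp only [Pi.add_apply, sum_add_distrib]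
      have e2 : ∑ i, y i = ∑ i, x i + ∑ i, (y - x) i := by
        conv_lhs => rw [← add_tsub_cancel_of_le hxy]
        simp only [Pi.add_apply, sum_add_distrib]
      rw [e1, e2, hsum]
    · rw [hf_add, hfu, ← hf_add, add_tsub_cancel_of_le hxy]
    · calc toLex (u + (y - x)) < toLex (x + (y - x)) := by
            rw [toLex_add, toLex_add]
            exact add_lt_add_of_lt_of_le hlt le_rfl
        _ = toLex y := by rw [add_tsub_cancel_of_le hxy]
  -- Dickson's lemma: the minimal useless points
  have hWfin : {w | Minimal (· ∈ U) w}.Finite :=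
    WellQuasiOrderedLE.finite_of_isAntichain (setOf_minimal_antichain _)
  set W : Finset (Fin k → ℕ) := hWfin.toFinset with hW_def
  have hWU : ∀ x, x ∈ U ↔ ∃ w ∈ W, w ≤ x := by
    intro x
    constructor
    · intro hx
      obtain ⟨b, hbx, hb⟩ := exists_minimal_le_of_wellFoundedLT (· ∈ U) x hx
      exact ⟨b, hWfin.mem_toFinset.mpr hb, hbx⟩
    · rintro ⟨w, hw, hwx⟩
      exact hU w x (hWfin.mem_toFinset.mp hw).prop hwx
  -- `|f(σ(h))| = |σ(h) ∖ I|`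
  have hcount : ∀ h, #(((univ : Finset (Fin k)).piAntidiag h).image f) =
      #{x ∈ (univ : Finset (Fin k)).piAntidiag h | (0 : Fin k → ℕ) ≤ x ∧ ∀ w ∈ W, ¬ w ≤ x} := by
    intro h
    have hT : ∀ x, x ∈ ({x ∈ (univ : Finset (Fin k)).piAntidiag h | (0 : Fin k → ℕ) ≤ x ∧
        ∀ w ∈ W, ¬ w ≤ x} : Finset (Fin k → ℕ)) ↔
        x ∈ (univ : Finset (Fin k)).piAntidiag h ∧ x ∉ U := by
      intro x
      rw [mem_filter, hWU]
      simp only [zero_le, true_and, not_exists, not_and]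
    have himg : ((univ : Finset (Fin k)).piAntidiag h).image f =
        ({x ∈ (univ : Finset (Fin k)).piAntidiag h | (0 : Fin k → ℕ) ≤ x ∧
          ∀ w ∈ W, ¬ w ≤ x} : Finset (Fin k → ℕ)).image f := by
      apply Subset.antisymm
      · intro s hs
        rw [mem_image] at hs ⊢
        obtain ⟨x₀, hx₀, rfl⟩ := hs
        -- the lexicographically least point of the fibre of `f x₀` in `σ(h)`
        obtain ⟨m, hm, hmin⟩ := exists_min_image
          {x ∈ (univ : Finset (Fin k)).piAntidiag h | f x = f x₀} toLex
          ⟨x₀, mem_filter.mpr ⟨hx₀, rfl⟩⟩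
        rw [mem_filter] at hm
        refine ⟨m, (hT m).mpr ⟨hm.1, ?_⟩, hm.2⟩
        rintro ⟨u, hsum, hfu, hlt⟩
        have hu : u ∈ ({x ∈ (univ : Finset (Fin k)).piAntidiag h | f x = f x₀} :
            Finset (Fin k → ℕ)) := by
          rw [mem_filter, mem_piAntidiag_univ, hsum, ← mem_piAntidiag_univ]
          exact ⟨hm.1, hfu.trans hm.2⟩
        exact absurd (hmin u hu) (not_le.mpr hlt)
      · exact image_subset_image (filter_subset _ _)
    rw [himg, card_image_of_injOn]
    intro x hx y hy hxy
    rw [mem_coe, hT, mem_piAntidiag_univ] at hx hy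
    by_contra hne
    have hne' : toLex x ≠ toLex y := fun h => hne (toLex_inj.mp h)
    rcases lt_or_gt_of_ne hne' with hlt | hlt
    · exact hy.2 ⟨x, by rw [hx.1, hy.1], hxy, hlt⟩
    · exact hx.2 ⟨y, by rw [hx.1, hy.1], hxy.symm, hlt⟩
  obtain ⟨p, hdeg, h₀, hp⟩ := card_filter_count_polynomial W 0
  exact ⟨p, hdeg, h₀, fun h hh => by rw [hcount h]; exact hp h hh⟩

/-- `hA = f(σ(h))` [cite: NathansonRuzsa2002, proof of Theorem 1: "if `x ∈ σ(h)` then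
`f(x) ∈ hA` and `f(σ(h)) = hA`"], for any enumeration `a : Fin k → S` of `A` (repetitions
allowed). -/
theorem nsmul_eq_image_piAntidiag (A : Finset S) (a : Fin k → S) (ha : ∀ s, s ∈ A ↔ ∃ i, a i = s)
    (h : ℕ) : h • A = ((univ : Finset (Fin k)).piAntidiag h).image fun x => ∑ i, x i • a i := by
  have hsingle : ∀ i : Fin k, ∑ j, (Pi.single i 1 : Fin k → ℕ) j • a j = a i := fun i => by
    rw [Fintype.sum_eq_single i fun j hj => by rw [Pi.single_eq_of_ne hj, zero_smul],
      Pi.single_eq_same, one_smul]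
  induction h with
  | zero =>
    ext s
    rw [zero_nsmul, Finset.mem_zero, mem_image]
    constructor
    · rintro rfl
      refine ⟨0, mem_piAntidiag_univ.mpr (by simp), by simp⟩
    · rintro ⟨x, hx, rfl⟩
      rw [mem_piAntidiag_univ, sum_eq_zero_iff] at hx
      exact sum_eq_zero fun i _ => by rw [hx i (mem_univ i), zero_smul]
  | succ n ih =>
    ext s
    rw [succ_nsmul', Finset.mem_add, mem_image]
    constructor
    · rintro ⟨b, hb, t, ht, rfl⟩
      obtain ⟨i, rfl⟩ := (ha b).mp hb
      rw [ih, mem_image] at ht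
      obtain ⟨x, hx, rfl⟩ := ht
      rw [mem_piAntidiag_univ] at hx
      refine ⟨x + Pi.single i 1, mem_piAntidiag_univ.mpr ?_, ?_⟩
      · simp only [Pi.add_apply, sum_add_distrib, hx]
        simp
      · simp only [Pi.add_apply, add_nsmul, sum_add_distrib, hsingle, add_comm]
    · rintro ⟨y, hy, rfl⟩
      rw [mem_piAntidiag_univ] at hy
      have hex : ∃ i, y i ≠ 0 := by
        by_contra hnone
        rw [sum_eq_zero fun i _ => ?_] at hy
        · omega
        · by_contra hi
          exact hnone ⟨i, hi⟩
      obtain ⟨i, hi⟩ := hex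
      set e : Fin k → ℕ := Pi.single i 1 with he
      have hle : e ≤ y := by
        intro j
        by_cases hj : j = i
        · rw [hj, he, Pi.single_eq_same]
          exact Nat.one_le_iff_ne_zero.mpr hi
        · rw [he, Pi.single_eq_of_ne hj]
          exact Nat.zero_le _
      have hy' : y - e + e = y := tsub_add_cancel_of_le hle
      have hesum : ∑ j, e j = 1 := by simp [he]
      refine ⟨a i, (ha _).mpr ⟨i, rfl⟩, ∑ j, (y - e) j • a j, ?_, ?_⟩
      · rw [ih, mem_image]
        refine ⟨y - e, mem_piAntidiag_univ.mpr ?_, rfl⟩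
        have hs : ∑ j, y j = ∑ j, (y - e) j + ∑ j, e j := by
          conv_lhs => rw [← hy']
          simp only [Pi.add_apply, sum_add_distrib]
        omega
      · conv_rhs => rw [← hy']
        simp only [Pi.add_apply, add_nsmul, sum_add_distrib, he, hsingle, add_comm]

/-- **Khovanskii's theorem** [cite: Khovanskii1992, Theorem 1] in the form and with the proof of
[cite: NathansonRuzsa2002, Theorem 1]: "Let `S` be an abelian semigroup, and let `A` be a finite
nonempty subset of `S`. There exists a polynomial `p(t)` such that `|hA| = p(h)` for all
sufficiently large `h`."  Here `S` is an additive commutative monoid, `hA = h • A` (pointwise),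
`p ∈ ℚ[t]` has degree `≤ |A| − 1`, and the empty set is allowed (`h • ∅ = ∅` for `h ≥ 1`). -/
theorem khovanskii (A : Finset S) :
    ∃ p : ℚ[X], p.natDegree ≤ #A - 1 ∧ ∃ h₀ : ℕ, ∀ h, h₀ ≤ h →
      ((#(h • A) : ℕ) : ℚ) = p.eval (h : ℚ) := by
  obtain ⟨p, hdeg, h₀, hp⟩ :=
    card_image_piAntidiag_polynomial (k := #A) fun i => ((A.equivFin.symm i : A) : S)
  refine ⟨p, hdeg, h₀, fun h hh => ?_⟩
  rw [nsmul_eq_image_piAntidiag A (fun i => ((A.equivFin.symm i : A) : S)) ?_ h]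
  · exact hp h hh
  · intro s
    constructor
    · intro hs
      exact ⟨A.equivFin ⟨s, hs⟩, by simp⟩
    · rintro ⟨i, rfl⟩
      exact (A.equivFin.symm i).2

-- TODO(general form): [cite: NathansonRuzsa2002, Theorem 2] — `|h₁A₁ + ⋯ + h_rA_r|` is a
-- polynomial in `h₁, …, h_r` for all sufficiently large `h₁, …, h_r` (same proof with `r`-heights).

end Literature.Combinatorics.Additive.KhovanskiiTheorem
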